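import Mathlib
import Literature.Computability.AlgebraicComplexity.PermanentIrreducible

/-!
# Weight splitting of the four-row pencil span (crux `ValuativeGCT.ValuativeFlip`, line `four-row-count`)

Helper file (`--supports stmt-ValiantsHypothesis-12624`) for the `m`-free form `H` of the per-side
stub `stub_fourRowPencilRank` (`fourRowPencilRank_of_pencilCertificate`,
`Theorems/ValuativeGCTValuativeFlipFourRowTransfer.lean`):
`2⌊6n/5⌋² + ⌊6n/5⌋ + 2 ≤ finrank span{X_t · (∂_{ij} per_n)(M·X) : t < 4, i, j}` for a four-variable
pencil `M`.  Wall-breaker axis k10 ("rank / plethysm tables, small cases certified"): the tables of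
this quantity are computed PER WEIGHT CLASS, and this file is the lemma that makes a per-class table a
certificate — the CONCRETE half of the **class split** `PE3(a)` of
`Cruxes/ValuativeFlip/DECOMPOSITIONS.md`, in its general "potential" form (the abstract half —
"independence class by class combines", for families already known to be weighted-homogeneous — is
the sibling `Theorems/ValuativeGCTValuativeFlipPencilRankClassSplit.lean`, axis k2, landed the same
hour; here we prove that the generators ARE weighted-homogeneous, and give the `finrank` (table)
form rather than the `LinearIndependent` form):

* `pws_isWeightedHomogeneous_gen` — if the pencil is graded by a POTENTIAL, i.e. every nonzero cell
  entry `M (r, c) t ≠ 0` has `φ t = h c - h r` for some `φ : Fin 4 → W`, `h : n → W` (`W` any additive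
  commutative group), then every generator `X_t · (∂_{(i,j)} per)(M·X)` is weighted-homogeneous of
  weight `φ t + (h i - h j)` for the weight `φ` on the four variables (a term of `∂_{(i,j)} per` is a
  bijection `c ↦ ρ c` off column `j`, and `∑_{c ≠ j} (h c - h (ρ c)) = h i - h j` telescopes);
* `pws_finrank_span_eq_sum` — for ANY finite family of polynomials that are weighted-homogeneous
  (weights in any `W`), `finrank (span (range f)) = ∑_{classes} finrank (span (class))`
  (weighted-homogeneous submodules are independent: Mathlib's `weightedDecomposition`), with the
  `Fintype W` form `pws_finrank_span_eq_sum_univ` and the lower bound by any sub-family of classes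
  `pws_sum_finrank_le_finrank_span`;
* `pws_finrank_fourRowPencilSpan_eq_sum` — hence for a potential-graded pencil the rank of `H` is the
  SUM of the per-class ranks; instances: the cyclic band `M_{r, r+t} = w_{r,t} y_t` of the line card
  (`W = ZMod n`, `h = id`, `φ = id`: class `i - j + t`, `pws_finrank_cyclicBand_eq_sum`) and block
  gradings `W = ℤ`, `h r = ⌊r/k⌋`, `φ = (0, 0, -1, 1)` (graded block-tridiagonal pencils; apply the
  general statement).

All `2n - 2` Laplace relations `∑_j M_{ij} P_{ij} = per = ∑_i M_{ij} P_{ij}` live in class `0`, so a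
full-rank certificate is needed only class by class (`4n` generators each for the cyclic band):
* `pws_card_sub_card_classZero_le_finrank` (§3) — if every class `w ≠ 0` is linearly independent, the
  rank in `H` is `≥ 4·#cells − #(class 0)`; for the graded block-tridiagonal pencils of the rank tables
  (`Cruxes/ValuativeFlip` evidence `pencil_rank_tables_k10g1.md`: every class `w ≠ 0` is full in the
  sparse regime, `n ≤ 22`) this is `4n² − 8n + 8 ≥ 2⌊6n/5⌋² + ⌊6n/5⌋ + 2` (`n ≥ 9`), i.e. `H` reduces to
  per-class independence off class `0`.
Elementary; nothing here is specific to `ℂ`.  [this crux's DECOMPOSITIONS.md §1 PE3(a); folklore]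
-/

set_option linter.dupNamespace false

namespace Summit.ValiantsHypothesis.ValiantsHypothesis.Theorems.ValuativeFlip

open MvPolynomial Literature.Computability.AlgebraicComplexity
open scoped BigOperators

noncomputable section

/-! ## §1 Weighted-homogeneous families split by weight -/

section Split

variable {K : Type*} [Field K] {σ : Type*} {W : Type*} [AddCommMonoid W]

/-- The weighted-homogeneous submodules of a polynomial ring (weights in any additive commutative
monoid) form an independent family. [folklore; Mathlib `MvPolynomial.weightedDecomposition`] -/
theorem pws_iSupIndep_weightedHomogeneousSubmodule (w : σ → W) :
    iSupIndep (weightedHomogeneousSubmodule K w) := by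
  classical
  haveI := MvPolynomial.weightedDecomposition K w
  exact (DirectSum.Decomposition.isInternal (weightedHomogeneousSubmodule K w)).submodule_iSupIndep

/-- Dimension of a finite sup of an independent family of finite-dimensional subspaces (the ambient
space need not be finite-dimensional). [folklore] -/
theorem pws_finrank_finsetSup_eq_sum {V : Type*} [AddCommGroup V] [Module K V] {κ : Type*}
    {U : κ → Submodule K V} (hU : iSupIndep U) [∀ k, FiniteDimensional K (U k)] (s : Finset κ) :
    Module.finrank K ↥(s.sup U) = ∑ k ∈ s, Module.finrank K (U k) := by
  classical
  induction s using Finset.induction_on with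
  | empty => simp
  | insert a s ha ih =>
    rw [Finset.sup_insert, Finset.sum_insert ha, ← ih]
    have hdisj : Disjoint (U a) (s.sup U) := by
      have h := hU.disjoint_biSup (x := a) (y := (↑s : Set κ)) (by simpa using ha)
      rw [Finset.sup_eq_iSup]
      exact h
    have h := Submodule.finrank_sup_add_finrank_inf_eq (U a) (s.sup U)
    rwa [hdisj.eq_bot, finrank_bot, add_zero] at h

variable {ι : Type*} [Fintype ι]

/-- **Weight splitting of a span.**  If every member of a finite family of polynomials is
weighted-homogeneous (`f i` of weight `c i`, weights in any additive commutative monoid `W`), then the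
dimension of the span is the sum over the weight classes of the dimensions of the spans of the classes.
[folklore] -/
theorem pws_finrank_span_eq_sum [DecidableEq W] (w : σ → W) (f : ι → MvPolynomial σ K) (c : ι → W)
    (hf : ∀ i, IsWeightedHomogeneous w (f i) (c i)) :
    Module.finrank K ↥(Submodule.span K (Set.range f)) =
      ∑ m ∈ Finset.univ.image c, Module.finrank K ↥(Submodule.span K (f '' {i | c i = m})) := by
  classical
  set P : W → Submodule K (MvPolynomial σ K) := fun m => Submodule.span K (f '' {i | c i = m}) with hP
  have hPle : ∀ m, P m ≤ weightedHomogeneousSubmodule K w m := by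
    intro m
    refine Submodule.span_le.2 ?_
    rintro _ ⟨i, hi, rfl⟩
    have hi' : c i = m := hi
    rw [SetLike.mem_coe, mem_weightedHomogeneousSubmodule, ← hi']
    exact hf i
  have hind : iSupIndep P := (pws_iSupIndep_weightedHomogeneousSubmodule (K := K) w).mono hPle
  haveI : ∀ m, FiniteDimensional K (P m) := fun m =>
    FiniteDimensional.span_of_finite K ((Set.toFinite _).image f)
  have hspan : Submodule.span K (Set.range f) = (Finset.univ.image c).sup P := by
    apply le_antisymm
    · refine Submodule.span_le.2 ?_
      rintro _ ⟨i, rfl⟩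
      have hmem : f i ∈ P (c i) := Submodule.subset_span ⟨i, rfl, rfl⟩
      exact (Finset.le_sup (f := P) (Finset.mem_image_of_mem c (Finset.mem_univ i))) hmem
    · refine Finset.sup_le fun m _ => ?_
      exact Submodule.span_mono (Set.image_subset_range _ _)
  rw [hspan, pws_finrank_finsetSup_eq_sum hind]

/-- The same over all of a finite weight type (classes that do not occur contribute `0`). [folklore] -/
theorem pws_finrank_span_eq_sum_univ [Fintype W] [DecidableEq W] (w : σ → W)
    (f : ι → MvPolynomial σ K) (c : ι → W) (hf : ∀ i, IsWeightedHomogeneous w (f i) (c i)) :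
    Module.finrank K ↥(Submodule.span K (Set.range f)) =
      ∑ m, Module.finrank K ↥(Submodule.span K (f '' {i | c i = m})) := by
  classical
  rw [pws_finrank_span_eq_sum w f c hf]
  refine Finset.sum_subset (Finset.subset_univ _) fun m _ hm => ?_
  have hempty : {i | c i = m} = (∅ : Set ι) := by
    ext i
    simp only [Set.mem_setOf_eq, Set.mem_empty_iff_false, iff_false]
    intro hi
    exact hm (Finset.mem_image.2 ⟨i, Finset.mem_univ _, hi⟩)
  rw [hempty, Set.image_empty, Submodule.span_empty, finrank_bot]

/-- **Lower bound by a sub-collection of classes**: for weighted-homogeneous families, the sum of the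
per-class ranks over ANY finite set of weights is at most the rank of the whole family (classes are
independent; a class outside the image is empty).  This is the form a per-class rank TABLE certifies.
[folklore] -/
theorem pws_sum_finrank_le_finrank_span [DecidableEq W] (w : σ → W) (f : ι → MvPolynomial σ K)
    (c : ι → W) (hf : ∀ i, IsWeightedHomogeneous w (f i) (c i)) (T : Finset W) :
    ∑ m ∈ T, Module.finrank K ↥(Submodule.span K (f '' {i | c i = m})) ≤
      Module.finrank K ↥(Submodule.span K (Set.range f)) := by
  classical
  rw [pws_finrank_span_eq_sum w f c hf]
  refine Finset.sum_le_sum_of_ne_zero fun m _ hm => ?_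
  by_contra hnot
  apply hm
  have hempty : {i | c i = m} = (∅ : Set ι) := by
    ext i
    simp only [Set.mem_setOf_eq, Set.mem_empty_iff_false, iff_false]
    intro hi
    exact hnot (Finset.mem_image.2 ⟨i, Finset.mem_univ _, hi⟩)
  rw [hempty, Set.image_empty, Submodule.span_empty, finrank_bot]

end Split

/-! ## §2 Potential-graded pencils give weighted-homogeneous generators -/

section Pencil

/-- A cell of a potential-graded pencil is weighted-homogeneous of weight `h c - h r`. [folklore] -/
theorem pws_isWeightedHomogeneous_cell {K : Type*} [Field K] {n : Type*} {W : Type*} [AddCommGroup W]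
    (φ : Fin 4 → W) (h : n → W) (M : n × n → Fin 4 → K)
    (hM : ∀ r c t, M (r, c) t ≠ 0 → φ t = h c - h r) (rc : n × n) :
    IsWeightedHomogeneous φ (∑ t : Fin 4, M rc t • (X t : MvPolynomial (Fin 4) K)) (h rc.2 - h rc.1) := by
  refine IsWeightedHomogeneous.sum _ _ _ fun t _ => ?_
  by_cases ht : M rc t = 0
  · rw [ht, zero_smul]; exact isWeightedHomogeneous_zero K φ _
  · rw [smul_eq_C_mul, ← hM rc.1 rc.2 t ht]
    exact (isWeightedHomogeneous_X K φ t).C_mul _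

/-- The weight of a permutation monomial for a "potential difference" weight `(r, c) ↦ h c - h r` is
zero: `∑_c (h c - h (ρ c)) = 0`. [folklore] -/
theorem pws_weight_permMonomial_eq_zero {n : Type*} [Fintype n] {W : Type*} [AddCommGroup W]
    (h : n → W) (ρ : Equiv.Perm n) :
    Finsupp.weight (fun rc : n × n => h rc.2 - h rc.1) (permMonomial ρ) = 0 := by
  rw [permMonomial, map_sum]
  simp only [Finsupp.weight_apply, Finsupp.sum_single_index, zero_smul, one_smul]
  rw [Finset.sum_sub_distrib, sub_eq_zero]
  exact (Equiv.sum_comp ρ h).symm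

/-- For `ρ j = i`, the exponent `μ_ρ - e_{(i,j)}` of the term of `∂_{(i,j)} per` indexed by `ρ` has
potential weight `h i - h j`. [folklore] -/
theorem pws_weight_permMonomial_sub {n : Type*} [Fintype n] [DecidableEq n] {W : Type*}
    [AddCommGroup W] (h : n → W) {ρ : Equiv.Perm n} {i j : n} (hρ : ρ j = i) :
    Finsupp.weight (fun rc : n × n => h rc.2 - h rc.1) (permMonomial ρ - Finsupp.single (i, j) 1) =
      h i - h j := by
  have hle : Finsupp.single (i, j) 1 ≤ permMonomial ρ := by
    rw [Finsupp.single_le_iff, permMonomial_apply, if_pos hρ]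
  have hsum := pws_weight_permMonomial_eq_zero h ρ
  rw [← tsub_add_cancel_of_le hle, map_add] at hsum
  have hsingle : Finsupp.weight (fun rc : n × n => h rc.2 - h rc.1) (Finsupp.single (i, j) 1) =
      h j - h i := by
    simp [Finsupp.weight_apply]
  rw [hsingle] at hsum
  have := eq_neg_of_add_eq_zero_left hsum
  rw [this, neg_sub]

/-- **Generators of the four-row pencil span are weighted-homogeneous** for a potential-graded
pencil (every nonzero cell entry `M (r, c) t ≠ 0` has `φ t = h c - h r`): `X_t · (∂_{(i,j)} per)(M·X)`
has weight `φ t + (h i - h j)` — a term of `∂_{(i,j)} per` is a bijection `c ↦ ρ c` off column `j`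
with `ρ j = i`, and `∑_{c ≠ j} (h c - h (ρ c)) = h i - h j`.  [folklore; this crux's
DECOMPOSITIONS.md PE3(a)] -/
theorem pws_isWeightedHomogeneous_gen {K : Type*} [Field K] {n : Type*} [Fintype n] [DecidableEq n]
    {W : Type*} [AddCommGroup W] (φ : Fin 4 → W) (h : n → W) (M : n × n → Fin 4 → K)
    (hM : ∀ r c t, M (r, c) t ≠ 0 → φ t = h c - h r) (t : Fin 4) (i j : n) :
    IsWeightedHomogeneous φ
      ((X t : MvPolynomial (Fin 4) K) *
        aeval (fun rc : n × n => ∑ s : Fin 4, M rc s • (X s : MvPolynomial (Fin 4) K))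
          (pderiv (i, j) (perPoly n K)))
      (φ t + (h i - h j)) := by
  classical
  refine (isWeightedHomogeneous_X K φ t).mul ?_
  rw [perPoly_eq_sum_monomial, map_sum, map_sum]
  refine IsWeightedHomogeneous.sum _ _ _ fun ρ _ => ?_
  rw [pderiv_monomial, one_mul, permMonomial_apply]
  by_cases hρ : ρ j = i
  · rw [if_pos hρ, Nat.cast_one, aeval_monomial, map_one, one_mul, Finsupp.prod]
    have key := IsWeightedHomogeneous.prod (R := K) (w := φ)
      (permMonomial ρ - Finsupp.single (i, j) 1).support
      (fun rc : n × n => (∑ s : Fin 4, M rc s • (X s : MvPolynomial (Fin 4) K)) ^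
        ((permMonomial ρ - Finsupp.single (i, j) 1 : (n × n) →₀ ℕ) rc))
      (fun rc : n × n => ((permMonomial ρ - Finsupp.single (i, j) 1 : (n × n) →₀ ℕ) rc) • (h rc.2 - h rc.1))
      (fun rc _ => (pws_isWeightedHomogeneous_cell φ h M hM rc).pow _)
    have hw : ∑ rc ∈ (permMonomial ρ - Finsupp.single (i, j) 1 : (n × n) →₀ ℕ).support,
        ((permMonomial ρ - Finsupp.single (i, j) 1 : (n × n) →₀ ℕ) rc) • (h rc.2 - h rc.1) = h i - h j := by
      rw [← pws_weight_permMonomial_sub h hρ, Finsupp.weight_apply, Finsupp.sum]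
    rw [hw] at key
    exact key
  · rw [if_neg hρ, Nat.cast_zero, monomial_zero, map_zero]
    exact isWeightedHomogeneous_zero K φ _

/-- **The rank of the four-row pencil span is the sum of its per-class ranks** (potential-graded
pencils; classes `φ t + (h i - h j)`, any additive commutative group of weights). [this crux's
DECOMPOSITIONS.md PE3(a); folklore] -/
theorem pws_finrank_fourRowPencilSpan_eq_sum {K : Type*} [Field K] {n : Type*} [Fintype n]
    [DecidableEq n] {W : Type*} [AddCommGroup W] [DecidableEq W] (φ : Fin 4 → W) (h : n → W)
    (M : n × n → Fin 4 → K) (hM : ∀ r c t, M (r, c) t ≠ 0 → φ t = h c - h r) :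
    Module.finrank K ↥(Submodule.span K (Set.range fun tc : Fin 4 × (n × n) =>
        (X tc.1 : MvPolynomial (Fin 4) K) *
          aeval (fun rc : n × n => ∑ s : Fin 4, M rc s • (X s : MvPolynomial (Fin 4) K))
            (pderiv tc.2 (perPoly n K)))) =
      ∑ m ∈ Finset.univ.image (fun tc : Fin 4 × (n × n) => φ tc.1 + (h tc.2.1 - h tc.2.2)),
        Module.finrank K ↥(Submodule.span K ((fun tc : Fin 4 × (n × n) =>
          (X tc.1 : MvPolynomial (Fin 4) K) *
            aeval (fun rc : n × n => ∑ s : Fin 4, M rc s • (X s : MvPolynomial (Fin 4) K))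
              (pderiv tc.2 (perPoly n K))) ''
          {tc | φ tc.1 + (h tc.2.1 - h tc.2.2) = m})) := by
  classical
  exact pws_finrank_span_eq_sum φ
    (fun tc : Fin 4 × (n × n) => (X tc.1 : MvPolynomial (Fin 4) K) *
      aeval (fun rc : n × n => ∑ s : Fin 4, M rc s • (X s : MvPolynomial (Fin 4) K))
        (pderiv tc.2 (perPoly n K)))
    (fun tc : Fin 4 × (n × n) => φ tc.1 + (h tc.2.1 - h tc.2.2))
    fun tc => pws_isWeightedHomogeneous_gen φ h M hM tc.1 tc.2.1 tc.2.2

/-- **Per-class lower bound for the pencil certificate**: for a potential-graded pencil, the sum of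
the per-class ranks over any finite set of classes is a lower bound for the rank in `H`. [folklore] -/
theorem pws_sum_finrank_le_fourRowPencilSpan {K : Type*} [Field K] {n : Type*} [Fintype n]
    [DecidableEq n] {W : Type*} [AddCommGroup W] [DecidableEq W] (φ : Fin 4 → W) (h : n → W)
    (M : n × n → Fin 4 → K) (hM : ∀ r c t, M (r, c) t ≠ 0 → φ t = h c - h r) (T : Finset W) :
    ∑ m ∈ T, Module.finrank K ↥(Submodule.span K ((fun tc : Fin 4 × (n × n) =>
          (X tc.1 : MvPolynomial (Fin 4) K) *
            aeval (fun rc : n × n => ∑ s : Fin 4, M rc s • (X s : MvPolynomial (Fin 4) K))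
              (pderiv tc.2 (perPoly n K))) ''
          {tc | φ tc.1 + (h tc.2.1 - h tc.2.2) = m})) ≤
      Module.finrank K ↥(Submodule.span K (Set.range fun tc : Fin 4 × (n × n) =>
        (X tc.1 : MvPolynomial (Fin 4) K) *
          aeval (fun rc : n × n => ∑ s : Fin 4, M rc s • (X s : MvPolynomial (Fin 4) K))
            (pderiv tc.2 (perPoly n K)))) := by
  classical
  exact pws_sum_finrank_le_finrank_span φ
    (fun tc : Fin 4 × (n × n) => (X tc.1 : MvPolynomial (Fin 4) K) *
      aeval (fun rc : n × n => ∑ s : Fin 4, M rc s • (X s : MvPolynomial (Fin 4) K))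
        (pderiv tc.2 (perPoly n K)))
    (fun tc : Fin 4 × (n × n) => φ tc.1 + (h tc.2.1 - h tc.2.2))
    (fun tc => pws_isWeightedHomogeneous_gen φ h M hM tc.1 tc.2.1 tc.2.2) T

/-- **Class split for cyclic band pencils** (the line card's `M(y) = Σ_t y_t D_t P^t`, any number of
bands placed cyclically: cell `(r, c)` may carry `y_t` only if `c ≡ r + t (mod n)`): the rank in `H`
is the sum over the residues `q ∈ ℤ/n` of the ranks of the classes `{(t, i, j) : t + (i - j) ≡ q}`.
[this crux's DECOMPOSITIONS.md PE3(a); folklore] -/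
theorem pws_finrank_cyclicBand_eq_sum {K : Type*} [Field K] (n : ℕ) [NeZero n]
    (M : Fin n × Fin n → Fin 4 → K)
    (hM : ∀ (r c : Fin n) (t : Fin 4), M (r, c) t ≠ 0 → ((c : ℕ) : ZMod n) = (r : ℕ) + (t : ℕ)) :
    Module.finrank K ↥(Submodule.span K (Set.range fun tc : Fin 4 × (Fin n × Fin n) =>
        (X tc.1 : MvPolynomial (Fin 4) K) *
          aeval (fun rc : Fin n × Fin n => ∑ s : Fin 4, M rc s • (X s : MvPolynomial (Fin 4) K))
            (pderiv tc.2 (perPoly (Fin n) K)))) =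
      ∑ q : ZMod n, Module.finrank K ↥(Submodule.span K ((fun tc : Fin 4 × (Fin n × Fin n) =>
          (X tc.1 : MvPolynomial (Fin 4) K) *
            aeval (fun rc : Fin n × Fin n => ∑ s : Fin 4, M rc s • (X s : MvPolynomial (Fin 4) K))
              (pderiv tc.2 (perPoly (Fin n) K))) ''
          {tc | ((tc.1 : ℕ) : ZMod n) + (((tc.2.1 : ℕ) : ZMod n) - ((tc.2.2 : ℕ) : ZMod n)) = q})) := by
  classical
  refine pws_finrank_span_eq_sum_univ (W := ZMod n) (fun t : Fin 4 => ((t : ℕ) : ZMod n)) _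
    (fun tc : Fin 4 × (Fin n × Fin n) =>
      ((tc.1 : ℕ) : ZMod n) + (((tc.2.1 : ℕ) : ZMod n) - ((tc.2.2 : ℕ) : ZMod n)))
    fun tc => ?_
  refine pws_isWeightedHomogeneous_gen (W := ZMod n) (fun t : Fin 4 => ((t : ℕ) : ZMod n))
    (fun r : Fin n => ((r : ℕ) : ZMod n)) M (fun r c t hrc => ?_) tc.1 tc.2.1 tc.2.2
  rw [hM r c t hrc]
  ring


/-! ## §3 All relations live in class `0`: rank `≥ 4n² − #(class 0)` from off-zero independence -/

/-- The span of the image of a class equals the span of the range of the class as a subtype family.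
[folklore] -/
theorem pws_span_image_eq_span_range_subtype {K : Type*} [Field K] {V : Type*} [AddCommGroup V]
    [Module K V] {ι : Type*} {W : Type*} (f : ι → V) (c : ι → W) (m : W) :
    Submodule.span K (f '' {i | c i = m}) =
      Submodule.span K (Set.range fun i : {i : ι // c i = m} => f i.1) := by
  congr 1
  ext x
  simp only [Set.mem_image, Set.mem_setOf_eq, Set.mem_range, Subtype.exists, exists_prop]

/-- **Off-zero independence gives the count.**  For a potential-graded pencil, the `2n − 2` Laplace
relations `Σ_j M_{ij} P_{ij} = per = Σ_i M_{ij} P_{ij}` all live in class `0` (a cell `(i, j)` carrying `y_t`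
has `φ t + (h i − h j) = 0`); so if every class `w ≠ 0` is linearly independent — the per-class statement
the rank tables point to (`Cruxes/ValuativeFlip` evidence `pencil_rank_tables_k10g1.md`: graded
block-tridiagonal pencils, every class `w ≠ 0` full in the sparse regime, `n ≤ 22`) — then the rank in
`H` is at least `4·#cells − #(class 0)` (`= 4n² − (8n − 8)` for the block size `2` chain).  [this crux's
line four-row-count; folklore] -/
theorem pws_card_sub_card_classZero_le_finrank {K : Type*} [Field K] {n : Type*} [Fintype n]
    [DecidableEq n] {W : Type*} [AddCommGroup W] [DecidableEq W] (φ : Fin 4 → W) (h : n → W)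
    (M : n × n → Fin 4 → K) (hM : ∀ r c t, M (r, c) t ≠ 0 → φ t = h c - h r)
    (hind : ∀ w : W, w ≠ 0 → LinearIndependent K fun tc : {tc : Fin 4 × (n × n) //
        φ tc.1 + (h tc.2.1 - h tc.2.2) = w} =>
          (X tc.1.1 : MvPolynomial (Fin 4) K) *
            aeval (fun rc : n × n => ∑ s : Fin 4, M rc s • (X s : MvPolynomial (Fin 4) K))
              (pderiv tc.1.2 (perPoly n K))) :
    Fintype.card (Fin 4 × (n × n)) -
        (Finset.univ.filter fun tc : Fin 4 × (n × n) => φ tc.1 + (h tc.2.1 - h tc.2.2) = 0).card ≤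
      Module.finrank K ↥(Submodule.span K (Set.range fun tc : Fin 4 × (n × n) =>
        (X tc.1 : MvPolynomial (Fin 4) K) *
          aeval (fun rc : n × n => ∑ s : Fin 4, M rc s • (X s : MvPolynomial (Fin 4) K))
            (pderiv tc.2 (perPoly n K)))) := by
  classical
  set gen : Fin 4 × (n × n) → MvPolynomial (Fin 4) K := fun tc =>
    (X tc.1 : MvPolynomial (Fin 4) K) *
      aeval (fun rc : n × n => ∑ s : Fin 4, M rc s • (X s : MvPolynomial (Fin 4) K))
        (pderiv tc.2 (perPoly n K)) with hgen
  set cls : Fin 4 × (n × n) → W := fun tc => φ tc.1 + (h tc.2.1 - h tc.2.2) with hcls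
  set I : Finset W := Finset.univ.image cls with hI
  -- per-class sums bound the rank
  have hsum := pws_sum_finrank_le_fourRowPencilSpan φ h M hM (I.erase 0)
  -- each class `m ≠ 0` has finrank = card
  have hclass : ∀ m ∈ I.erase 0,
      Module.finrank K ↥(Submodule.span K (gen '' {tc | cls tc = m})) =
        (Finset.univ.filter fun tc : Fin 4 × (n × n) => cls tc = m).card := by
    intro m hm
    have hm0 : m ≠ 0 := (Finset.mem_erase.1 hm).1
    rw [pws_span_image_eq_span_range_subtype gen cls m, finrank_span_eq_card (hind m hm0),
      Fintype.card_subtype]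
  have hsum' : ∑ m ∈ I.erase 0, (Finset.univ.filter fun tc : Fin 4 × (n × n) => cls tc = m).card ≤
      Module.finrank K ↥(Submodule.span K (Set.range gen)) := by
    calc ∑ m ∈ I.erase 0, (Finset.univ.filter fun tc : Fin 4 × (n × n) => cls tc = m).card
        = ∑ m ∈ I.erase 0, Module.finrank K ↥(Submodule.span K (gen '' {tc | cls tc = m})) :=
          Finset.sum_congr rfl fun m hm => (hclass m hm).symm
      _ ≤ _ := hsum
  -- the classes partition all generators
  have htot : Fintype.card (Fin 4 × (n × n)) =
      ∑ m ∈ I, (Finset.univ.filter fun tc : Fin 4 × (n × n) => cls tc = m).card := by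
    rw [← Finset.card_univ]
    exact Finset.card_eq_sum_card_image cls Finset.univ
  by_cases h0 : (0 : W) ∈ I
  · have hsplit := Finset.add_sum_erase I
      (fun m => (Finset.univ.filter fun tc : Fin 4 × (n × n) => cls tc = m).card) h0
    -- card univ = card(class 0) + Σ_{m ≠ 0}
    have : Fintype.card (Fin 4 × (n × n)) -
        (Finset.univ.filter fun tc : Fin 4 × (n × n) => cls tc = 0).card =
          ∑ m ∈ I.erase 0, (Finset.univ.filter fun tc : Fin 4 × (n × n) => cls tc = m).card := by
      rw [htot, ← hsplit]
      simp
    rw [this]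
    exact hsum'
  · -- class 0 empty: the erase changes nothing
    have hempty : (Finset.univ.filter fun tc : Fin 4 × (n × n) => cls tc = 0).card = 0 := by
      rw [Finset.card_eq_zero, Finset.filter_eq_empty_iff]
      intro tc _ htc
      exact h0 (Finset.mem_image.2 ⟨tc, Finset.mem_univ _, htc⟩)
    rw [hempty, Nat.sub_zero, htot, ← Finset.erase_eq_of_notMem h0]
    exact hsum'

end Pencil

end

end Summit.ValiantsHypothesis.ValiantsHypothesis.Theorems.ValuativeFlip
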